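import Literature.Barriers.NavierStokesRegularity.NavierStokesInequalityMultiProfileBlock
import HarnessLib

/-!
# Pointwise bounds for the level field from bounds on its pieces (Ożański 2017, §6.3 Step 3 (iv))

Support file on the discharge path of fact D′
`Literature.Barriers.NavierStokesRegularity.NSICantorBlock_of_arrangement`. In W. S. Ożański,
arXiv:1709.00602v4, §6.3 Step 3, the bounds behind claim (iv) of Proposition 16 and the
viscosity threshold (6.26) are stated PIECE BY PIECE and transferred to the level field
`v = Σ_𝔪 (u[a₁v₁^𝔪,q₁^𝔪] + u[a₂v₂^𝔪,q₂^𝔪])` ((6.22)) through the disjointness of the supports: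
"`|v(x,t)| = Σ_𝔪 |q₁^{𝔪,k}_t(R⁻¹x) + q₂^{𝔪,k}_t(R⁻¹x)|` (recall that [the profiles] have disjoint
supports) … `≤ 𝒞`", "`|∇v(x,t)| ≤ Σ_𝔪 |∇u[a₁v₁^𝔪,q₁^𝔪](x) + ∇u[a₂v₂^𝔪,q₂^𝔪](x)| ≤ max_𝔪 𝒞(…) = 𝒞`"
(p. 31–32). For the `ι`-indexed data of `NavierStokesInequalityMultiProfileBlock` this file PROVES:

* `IsNSIMultiProfileData.norm_le_of_forall` — `|v(x,t)| ≤ B` if every profile satisfies `Q_r(t) ≤ B`;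
* `IsNSIMultiProfileData.fderiv_eq_of_mem` / `…_eq_zero` — `∇v(t) = ∇u_r(t)` over `Ū_r`, `= 0`
  off all solids (locality), whence `frobeniusNormSq_fderiv_le_of_forall` — `|∇v(x,t)|² ≤ B` if
  every piece satisfies `|∇u_r(x,t)|² ≤ B`;
* `IsNSIMultiProfileData.inner_laplacian_ge_of_forall` — `v·Δv ≥ -Λ` if every piece satisfies
  `u_r·Δu_r ≥ -Λ` (the form in which (6.26) enters the Navier–Stokes inequality).

## References

* W. S. Ożański, *On weak solutions to the Navier–Stokes inequality with internal
  singularities*, arXiv:1709.00602v4, §6.3 Step 3, (6.26) and pp. 31–32. [`Ozanski2017NSISingular`]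
-/

noncomputable section

open MeasureTheory Set Function Filter Topology TopologicalSpace WithLp Metric
open scoped ENNReal InnerProductSpace RealInnerProductSpace ContDiff Laplacian

namespace Literature.Barriers.NavierStokesRegularity

open Literature.Analysis.FluidPDE

/-- Local notation for physical space `ℝ³ = EuclideanSpace ℝ (Fin 3)`. -/
local notation "ℝ³" => EuclideanSpace ℝ (Fin 3)

namespace IsNSIMultiProfileData

variable {ι : Type*} [Fintype ι] {U : ι → Set (ℝ × ℝ)} {v : ι → ℝ × ℝ → ℝ × ℝ} {T η δ : ℝ}
  {C : ι → Set (ℝ × ℝ)} {a : ι → ℝ → ℝ} {Q : ι → ℝ → ℝ × ℝ → ℝ}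

/-- **`|v(x,t)| ≤ B` from `Q_r(t) ≤ B`** (p. 31: "`|v(x,t)| = Σ_𝔪|q₁^𝔪(R⁻¹x) + q₂^𝔪(R⁻¹x)| ≤ … = 𝒞`
since the profiles have disjoint supports": at most one profile is nonzero at `R⁻¹x`).
[cite: Ozanski2017NSISingular, §6.3 Step 3, p. 31] -/
theorem norm_le_of_forall (h : IsNSIMultiProfileData U v T η δ C a Q) {t : ℝ}
    (ht : t ∈ Ioo (-η) (T + η)) {B : ℝ} (hB0 : 0 ≤ B) (hB : ∀ r q, Q r t q ≤ B) (x : ℝ³) :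
    ‖multiProfileField v a Q t x‖ ≤ B := by
  by_cases hx : ∃ r, meridian x ∈ closure (U r)
  · obtain ⟨r, hr⟩ := hx
    rw [h.apply_of_mem ht hr, (h.slice r ht).norm_swirlField_eq]
    exact hB r _
  · push Not at hx
    rw [h.apply_of_forall_notMem ht hx, norm_zero]
    exact hB0

/-- **Over `Ū_r`, `∇v(t) = ∇u_r(t)`** (locality of the derivative; `u_r = u[a_rv_r, Q_r]`).
[cite: Ozanski2017NSISingular, §6.3 Step 3, p. 32] -/
theorem fderiv_eq_of_mem (h : IsNSIMultiProfileData U v T η δ C a Q) {t : ℝ}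
    (ht : t ∈ Ioo (-η) (T + η)) {r : ι} {x : ℝ³} (hx : meridian x ∈ closure (U r)) :
    fderiv ℝ (multiProfileField v a Q t) x = fderiv ℝ (swirlField (a r t • v r) (Q r t)) x :=
  (h.eventuallyEq_single ht r fun _ hr' => h.notMem_closure_of_ne hr' hx).fderiv_eq

/-- Off all solids, `∇v(t) = 0`. [folklore] -/
theorem fderiv_eq_zero (h : IsNSIMultiProfileData U v T η δ C a Q) {t : ℝ}
    (ht : t ∈ Ioo (-η) (T + η)) {x : ℝ³} (hx : ∀ r, meridian x ∉ closure (U r)) :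
    fderiv ℝ (multiProfileField v a Q t) x = 0 := by
  rw [(h.eventuallyEq_zero ht hx).fderiv_eq]
  exact fderiv_const_apply _

/-- **`|∇v(x,t)|² ≤ B` from `|∇u_r(x,t)|² ≤ B` for every piece** (p. 32: "`|∇v(x,t)| ≤
Σ_𝔪|∇u[a₁v₁^𝔪,q₁^𝔪](x) + ∇u[a₂v₂^𝔪,q₂^𝔪](x)| ≤ max_𝔪 𝒞(…) = 𝒞`"; squared Frobenius norms).
[cite: Ozanski2017NSISingular, §6.3 Step 3, p. 32] -/
theorem frobeniusNormSq_fderiv_le_of_forall (h : IsNSIMultiProfileData U v T η δ C a Q) {t : ℝ}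
    (ht : t ∈ Ioo (-η) (T + η)) {B : ℝ} (hB0 : 0 ≤ B)
    (hB : ∀ r x, frobeniusNormSq (fderiv ℝ (swirlField (a r t • v r) (Q r t)) x) ≤ B) (x : ℝ³) :
    frobeniusNormSq (fderiv ℝ (multiProfileField v a Q t) x) ≤ B := by
  by_cases hx : ∃ r, meridian x ∈ closure (U r)
  · obtain ⟨r, hr⟩ := hx
    rw [h.fderiv_eq_of_mem ht hr]
    exact hB r x
  · push Not at hx
    rw [h.fderiv_eq_zero ht hx, frobeniusNormSq_zero]
    exact hB0

/-- **`v·Δv ≥ -Λ` from `u_r·Δu_r ≥ -Λ` for every piece** (the lower bound through which (6.26)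
enters the Navier–Stokes inequality; over `Ū_r` the pairing is that of the piece, elsewhere
`v = 0`). [cite: Ozanski2017NSISingular, §6.3 Step 3 (6.26)] -/
theorem inner_laplacian_ge_of_forall (h : IsNSIMultiProfileData U v T η δ C a Q) {t : ℝ}
    (ht : t ∈ Ioo (-η) (T + η)) {Λ : ℝ} (hΛ0 : 0 ≤ Λ)
    (hΛ : ∀ r x, -Λ ≤ ⟪swirlField (a r t • v r) (Q r t) x, (Δ (swirlField (a r t • v r) (Q r t))) x⟫)
    (x : ℝ³) : -Λ ≤ ⟪multiProfileField v a Q t x, (Δ (multiProfileField v a Q t)) x⟫ := by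
  by_cases hx : ∃ r, meridian x ∈ closure (U r)
  · obtain ⟨r, hr⟩ := hx
    rw [h.inner_laplacian_eq_of_mem ht hr]
    exact hΛ r x
  · push Not at hx
    rw [h.apply_of_forall_notMem ht hx, inner_zero_left]
    linarith

/-- **The Navier–Stokes inequality with the threshold (6.26) in Ożański's form**: if every piece
satisfies `u_r·Δu_r ≥ -Λ` on `[0,T] × ℝ³` and `2ν₀Λ ≤ δ`, then the level field satisfies the
pointwise Navier–Stokes inequality for every `ν ∈ [0,ν₀]` (`nsi` with `2ν₀ u_r·Δu_r ≥ -2ν₀Λ ≥ -δ`).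
[cite: Ozanski2017NSISingular, §6.3 Step 3 ((6.24)–(6.26))] -/
theorem nsi_of_forall_ge (h : IsNSIMultiProfileData U v T η δ C a Q) {ν₀ Λ : ℝ} (hν₀ : 0 ≤ ν₀)
    (hΛ : ∀ r, ∀ t ∈ Icc (0 : ℝ) T, ∀ x : ℝ³,
      -Λ ≤ ⟪swirlField (a r t • v r) (Q r t) x, (Δ (swirlField (a r t • v r) (Q r t))) x⟫)
    (hνΛ : 2 * ν₀ * Λ ≤ δ) {ν : ℝ} (hν : ν ∈ Icc (0 : ℝ) ν₀) {t : ℝ} (ht : t ∈ Icc (0 : ℝ) T)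
    (x : ℝ³) :
    timeDeriv (fun s y => ‖multiProfileField v a Q s y‖ ^ 2) t x ≤
      -⟪multiProfileField v a Q t x, gradient (fun y => ‖multiProfileField v a Q t y‖ ^ 2 +
          2 * normalisedPressure (multiProfileField v a Q t) y) x⟫ +
        2 * ν * ⟪multiProfileField v a Q t x, (Δ (multiProfileField v a Q t)) x⟫ :=
  h.nsi (fun r s hs y => by
    have h1 := hΛ r s hs y
    have h2 : 2 * ν₀ * -Λ ≤ 2 * ν₀ *
        ⟪swirlField (a r s • v r) (Q r s) y, (Δ (swirlField (a r s • v r) (Q r s))) y⟫ :=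
      mul_le_mul_of_nonneg_left h1 (by positivity)
    linarith) hν ht x

end IsNSIMultiProfileData

end Literature.Barriers.NavierStokesRegularity
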